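import Summits.CriticalPhenomena.PercolationContinuityZ3.Theorems.PercNearOneGluingNoHeavyLowerTailSahiThreeDimFKG
import Summits.CriticalPhenomena.PercolationContinuityZ3.Theorems.PercNearOneGluingNoHeavyLowerTailSahiThreeChainOrderThree

/-!
# Sahi's `C₃` in dimension three, V: EVERY FKG weight on a product of three finite chains, and every finite distributive lattice of
# J-width ≤ 3, is Sahi-positive of order 3

Support file of the one-cut programme (crux `NoHeavyLowerTail`, stmt-CriticalPhenomena-4575; cell `prim-masterthm`, seat P3, gen 17;
`run/shared/lean/prim/prim-masterthm/prim-masterthm-p3/HIERARCHY.md` §25; memo `run/shared/lean/prim/prim-masterthm/FROM-prim-masterthm-p3-g17-THREE-CHAINS-C3.md`).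

The tree's three-dimensional reduction `…SahiThreeDimFKG` (seat prim-sahi-p1): "IF every product probability weight on every product of three finite chains is
Sahi-positive of every order THEN so is every FKG weight on such a product and on every finite distributive lattice lattice-embeddable in one" — its proof is
ORDER BY ORDER (Rosenblatt / conditional-quantile couplings `SahiThreeDim.exists_coupling`, `SahiPositive.of_pushWeight`).  Gen 17 proved the hypothesis AT ORDER 3
(`SahiThreeChain.sahiPositive_three_prodWeight3`, `…SahiThreeChainOrderThree`: computer-assisted kernel theorem).  This file runs the same reduction at order 3:
* `sahiPositive_prodWeight₃_three` — order-3 Sahi positivity of `w₁ ⊗ w₂ ⊗ w₃` on `(ι × κ) × θ` (transport of gen 17's theorem along `Equiv.prodAssoc`);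
* `sahiPositive_three_of_isFKGMeasure_prod₃_fin`, **`sahiPositive_three_of_isFKGMeasure_prod₃`**, `sahiPositive_three_of_isFKGMeasure_prod₃'` — **every FKG
  (log-supermodular) probability weight on a product of three finite chains is Sahi-positive of order 3: `E₃(f,g,h) ≥ 0` for all nonnegative monotone `f,g,h`**;
* **`sahiPositive_three_of_latticeEmbedding_prod₃`** — the same on every finite distributive lattice admitting a `⊓,⊔`-embedding into a product of three finite chains
  (J-width `≤ 3`; e.g. `[2]×[2]×[3]`, `WithBot(2²)×2`).
So Sahi's Conjecture 5 / Richards' `κ′₃ ≥ 0` holds at `n = 3` on all three-dimensional FKG lattices.  HONEST LABEL: proofs = the tree's reduction verbatim at order 3;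
the base theorem is computer-assisted (`native_decide`, `…SlotCertificate`); axioms otherwise standard.  `C₃` on cubes of dimension `≥ 4` and `C_k`, `k ≥ 4`, remain OPEN.
[this work]
-/

namespace Summit.CriticalPhenomena.PercolationContinuityZ3.Theorems.SahiThreeDim

open Finset Function Literature.Combinatorics.Sahi2008 SahiTwoDim
open scoped BigOperators

noncomputable section

section Transport

variable {ι κ θ : Type*} [LinearOrder ι] [Fintype ι] [LinearOrder κ] [Fintype κ] [LinearOrder θ] [Fintype θ]

/-- **Order-3 Sahi positivity of a triple product weight** on `(ι × κ) × θ` (gen 17's `SahiThreeChain.sahiPositive_three_prodWeight3`, transported along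
`Equiv.prodAssoc`). [this work] -/
theorem sahiPositive_prodWeight₃_three (w₁ : ι → ℝ) (w₂ : κ → ℝ) (w₃ : θ → ℝ) (h₁0 : ∀ i, 0 ≤ w₁ i) (h₁1 : ∑ i, w₁ i = 1)
    (h₂0 : ∀ j, 0 ≤ w₂ j) (h₂1 : ∑ j, w₂ j = 1) (h₃0 : ∀ k, 0 ≤ w₃ k) (h₃1 : ∑ k, w₃ k = 1) :
    SahiPositive (fun p : (ι × κ) × θ => w₁ p.1.1 * w₂ p.1.2 * w₃ p.2) 3 := by
  classical
  have h3 : SahiPositive (SahiThreeChain.prodWeight3 w₁ w₂ w₃) 3 :=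
    SahiThreeChain.sahiPositive_three_prodWeight3 w₁ w₂ w₃ h₁0 h₂0 h₃0 h₁1 h₂1 h₃1
  obtain ⟨E, hE⟩ : ∃ E : ι × κ × θ ≃ (ι × κ) × θ, E = (Equiv.prodAssoc ι κ θ).symm := ⟨_, rfl⟩
  have hEmono : Monotone E := fun p q h => by
    rw [hE]
    exact ⟨⟨h.1, h.2.1⟩, h.2.2⟩
  have hpush : pushWeight (SahiThreeChain.prodWeight3 w₁ w₂ w₃) E = fun p : (ι × κ) × θ => w₁ p.1.1 * w₂ p.1.2 * w₃ p.2 := by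
    funext q
    rw [pushWeight_equiv, hE]
    rcases q with ⟨⟨i, j⟩, k⟩
    rfl
  rw [← hpush]
  exact SahiPositive.of_pushWeight h3 hEmono

end Transport

section Main

variable {α : Type*} [LinearOrder α] [Fintype α]

/-- Core of the order-3 reduction (columns `Fin (b+1)`, `Fin (c+1)`): every FKG probability weight on `(α × Fin (b+1)) × Fin (c+1)` is Sahi-positive of
order 3 (the tree's `sahiPositive_of_isFKGMeasure_prod₃_fin`, verbatim at `n = 3` with the hypothesis discharged). [this work] -/
theorem sahiPositive_three_of_isFKGMeasure_prod₃_fin {b c : ℕ} {μ : (α × Fin (b + 1)) × Fin (c + 1) → ℝ} (hμ : IsFKGMeasure μ) :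
    SahiPositive μ 3 := by
  classical
  have hα : Nonempty α := by
    by_contra h
    rw [not_nonempty_iff] at h
    have h0 : ∑ p, μ p = 0 := by
      rw [Fintype.sum_prod_type, Fintype.sum_prod_type]
      exact Fintype.sum_empty _
    exact one_ne_zero (hμ.sum_eq_one.symm.trans h0)
  obtain ⟨ν, hν⟩ : ∃ ν : α × Fin (b + 1) → ℝ, ν = fun p => ∑ u, μ (p, u) := ⟨_, rfl⟩
  have hνFKG : IsFKGMeasure ν := by
    rw [hν, ← pushWeight_fst_eq]
    exact hμ.pushWeight_fst
  obtain ⟨K₂, hK₂, g₂, hg₂0, hg₂1, G₂, hG₂mono, hG₂push⟩ := exists_coupling ν hνFKG.nonneg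
    (fun i i' j hii' _ _ => SahiTwoDim.cdf_cross_of_mul_le_mul ν hνFKG.mul_le_mul hii' j)
  obtain ⟨K₃, hK₃, g₃, hg₃0, hg₃1, G₃, hG₃mono, hG₃push⟩ := exists_coupling μ hμ.nonneg
    (fun p p' u hpp' _ _ => cdf_cross_of_mul_le_mul μ hμ.mul_le_mul hpp' u)
  haveI : Nonempty (Fin K₂) := ⟨⟨0, hK₂⟩⟩
  haveI : Nonempty (Fin K₃) := ⟨⟨0, hK₃⟩⟩
  have hr0 : ∀ i, 0 ≤ ∑ j, ν (i, j) := fun i => sum_nonneg fun j _ => hνFKG.nonneg _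
  have hr1 : ∑ i, (∑ j, ν (i, j)) = 1 := by rw [sum_rowMass, hνFKG.sum_eq_one]
  have hπ : SahiPositive (fun x : (α × Fin K₂) × Fin K₃ => (∑ j, ν (x.1.1, j)) * g₂ x.1.2 * g₃ x.2) 3 :=
    sahiPositive_prodWeight₃_three (fun i => ∑ j, ν (i, j)) g₂ g₃ hr0 hr1 hg₂0 hg₂1 hg₃0 hg₃1
  have hFmono : Monotone (fun x : (α × Fin K₂) × Fin K₃ => (G₂ x.1, x.2)) :=
    fun x x' h => ⟨hG₂mono h.1, h.2⟩
  have hθ : SahiPositive (fun y : (α × Fin (b + 1)) × Fin K₃ => ν y.1 * g₃ y.2) 3 := by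
    have h := pushWeight_prodMap_id (fun p : α × Fin K₂ => (∑ j, ν (p.1, j)) * g₂ p.2) g₃ G₂
    rw [hG₂push] at h
    rw [← h]
    exact SahiPositive.of_pushWeight hπ hFmono
  have hθ' : (fun q : (α × Fin (b + 1)) × Fin K₃ => (∑ u, μ (q.1, u)) * g₃ q.2) =
      fun y => ν y.1 * g₃ y.2 := by
    funext q; rw [hν]
  rw [← hG₃push, hθ']
  exact SahiPositive.of_pushWeight hθ hG₃mono

/-- **SAHI'S `C₃` FOR EVERY FKG WEIGHT ON A PRODUCT OF THREE FINITE CHAINS.**  For all finite chains `α, β, γ` and every FKG (log-supermodular)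
probability weight `μ` on `(α × β) × γ`: `SahiPositive μ 3`, i.e. `E₃(f,g,h) ≥ 0` for all nonnegative monotone `f, g, h`.  (Sahi's Conjecture 5 / Richards' `κ′₃ ≥ 0`
at `n = 3` on all three-dimensional FKG product lattices.) [this work] -/
theorem sahiPositive_three_of_isFKGMeasure_prod₃ {β γ : Type*} [LinearOrder β] [Fintype β] [LinearOrder γ] [Fintype γ]
    {μ : (α × β) × γ → ℝ} (hμ : IsFKGMeasure μ) : SahiPositive μ 3 := by
  classical
  have hne : Nonempty ((α × β) × γ) := by
    by_contra h
    rw [not_nonempty_iff] at h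
    exact one_ne_zero (hμ.sum_eq_one.symm.trans (Fintype.sum_empty _))
  obtain ⟨⟨⟨-, j₀⟩, k₀⟩⟩ := hne
  haveI : Nonempty β := ⟨j₀⟩
  haveI : Nonempty γ := ⟨k₀⟩
  obtain ⟨b, hb⟩ : ∃ b, Fintype.card β = b + 1 := Nat.exists_eq_succ_of_ne_zero Fintype.card_ne_zero
  obtain ⟨c, hc⟩ : ∃ c, Fintype.card γ = c + 1 := Nat.exists_eq_succ_of_ne_zero Fintype.card_ne_zero
  obtain ⟨e₂, -⟩ : ∃ e : Fin (b + 1) ≃o β, True := ⟨Fintype.orderIsoFinOfCardEq β hb, trivial⟩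
  obtain ⟨e₃, -⟩ : ∃ e : Fin (c + 1) ≃o γ, True := ⟨Fintype.orderIsoFinOfCardEq γ hc, trivial⟩
  obtain ⟨E, hE⟩ : ∃ E : (α × Fin (b + 1)) × Fin (c + 1) ≃ (α × β) × γ,
      E = ((Equiv.refl α).prodCongr e₂.toEquiv).prodCongr e₃.toEquiv := ⟨_, rfl⟩
  have hEmono : Monotone E := fun p q h => by
    rw [hE]
    exact ⟨⟨h.1.1, e₂.monotone h.1.2⟩, e₃.monotone h.2⟩
  have hEinf : ∀ p q, E (p ⊓ q) = E p ⊓ E q := fun p q => by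
    rw [hE]; ext <;> simp [e₂.map_inf, e₃.map_inf]
  have hEsup : ∀ p q, E (p ⊔ q) = E p ⊔ E q := fun p q => by
    rw [hE]; ext <;> simp [e₂.map_sup, e₃.map_sup]
  obtain ⟨μ', hμ'⟩ : ∃ μ' : (α × Fin (b + 1)) × Fin (c + 1) → ℝ, μ' = fun p => μ (E p) := ⟨_, rfl⟩
  have hFKG : IsFKGMeasure μ' := by
    refine ⟨fun p => by rw [hμ']; exact hμ.nonneg _, ?_, fun p q => ?_⟩
    · rw [hμ', ← hμ.sum_eq_one]
      exact E.sum_comp (fun p => μ p)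
    · rw [hμ']
      have h := hμ.mul_le_mul (E p) (E q)
      rwa [← hEinf, ← hEsup] at h
  have hpush : pushWeight μ' E = μ := by
    funext q
    rw [pushWeight_equiv, hμ']
    exact congrArg μ (E.apply_symm_apply q)
  rw [← hpush]
  exact SahiPositive.of_pushWeight (sahiPositive_three_of_isFKGMeasure_prod₃_fin hFKG) hEmono

/-- The same for the right-associated product `α × (β × γ)`. [this work] -/
theorem sahiPositive_three_of_isFKGMeasure_prod₃' {β γ : Type*} [LinearOrder β] [Fintype β] [LinearOrder γ] [Fintype γ]
    {μ : α × β × γ → ℝ} (hμ : IsFKGMeasure μ) : SahiPositive μ 3 := by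
  classical
  obtain ⟨E, hE⟩ : ∃ E : (α × β) × γ ≃ α × β × γ, E = Equiv.prodAssoc α β γ := ⟨_, rfl⟩
  have hEmono : Monotone E := fun p q h => by
    rw [hE]
    exact ⟨h.1.1, h.1.2, h.2⟩
  have hEinf : ∀ p q, E (p ⊓ q) = E p ⊓ E q := fun p q => by rw [hE]; rfl
  have hEsup : ∀ p q, E (p ⊔ q) = E p ⊔ E q := fun p q => by rw [hE]; rfl
  obtain ⟨μ', hμ'⟩ : ∃ μ' : (α × β) × γ → ℝ, μ' = fun p => μ (E p) := ⟨_, rfl⟩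
  have hFKG : IsFKGMeasure μ' := by
    refine ⟨fun p => by rw [hμ']; exact hμ.nonneg _, ?_, fun p q => ?_⟩
    · rw [hμ', ← hμ.sum_eq_one]
      exact E.sum_comp (fun p => μ p)
    · rw [hμ']
      have h := hμ.mul_le_mul (E p) (E q)
      rwa [← hEinf, ← hEsup] at h
  have hpush : pushWeight μ' E = μ := by
    funext q
    rw [pushWeight_equiv, hμ']
    exact congrArg μ (E.apply_symm_apply q)
  rw [← hpush]
  exact SahiPositive.of_pushWeight (sahiPositive_three_of_isFKGMeasure_prod₃ hFKG) hEmono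

/-- **Order 3 on sublattices of three-dimensional grids**: if a finite distributive lattice `L` admits an injective `⊓,⊔`-preserving map into a product of three
finite chains (J-width `≤ 3`), then every FKG probability weight on `L` is Sahi-positive of order 3. [this work] -/
theorem sahiPositive_three_of_latticeEmbedding_prod₃ {L : Type*} [DistribLattice L] [Fintype L] [DecidableEq L] {β γ : Type*} [LinearOrder β]
    [Fintype β] [LinearOrder γ] [Fintype γ] (e : L → (α × β) × γ) (he : Function.Injective e) (hinf : ∀ x y, e (x ⊓ y) = e x ⊓ e y)
    (hsup : ∀ x y, e (x ⊔ y) = e x ⊔ e y) {μ : L → ℝ} (hμ : IsFKGMeasure μ) : SahiPositive μ 3 := by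
  classical
  have hL : Nonempty L := by
    by_contra h
    rw [not_nonempty_iff] at h
    exact one_ne_zero (hμ.sum_eq_one.symm.trans (Fintype.sum_empty _))
  letI : OrderBot L := Fintype.toOrderBot L
  have hle : ∀ x y, e x ≤ e y ↔ x ≤ y := by
    intro x y
    constructor
    · intro h
      have h1 : e (x ⊓ y) = e x := by rw [hinf]; exact inf_eq_left.2 h
      exact inf_eq_left.1 (he h1)
    · intro h
      have h1 : e x ⊓ e y = e x := by rw [← hinf, inf_eq_left.2 h]
      exact inf_eq_left.1 h1
  obtain ⟨R, hR⟩ : ∃ R : (α × β) × γ → L, ∀ p, R p = (univ.filter fun x => e x ≤ p).sup id := ⟨_, fun p => rfl⟩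
  have hRmono : Monotone R := by
    intro p p' hpp'
    rw [hR, hR]
    refine Finset.sup_mono fun x hx => ?_
    rw [mem_filter] at hx ⊢
    exact ⟨hx.1, hx.2.trans hpp'⟩
  have hRE : ∀ x, R (e x) = x := by
    intro x
    rw [hR]
    refine le_antisymm (Finset.sup_le fun y hy => ?_) ?_
    · rw [mem_filter] at hy
      exact (hle y x).1 hy.2
    · exact Finset.le_sup (f := id) (by rw [mem_filter]; exact ⟨mem_univ _, le_rfl⟩)
  have hFKG : IsFKGMeasure (pushWeight μ e) := isFKGMeasure_pushWeight hμ he hinf hsup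
  exact SahiCubeAllOrders.sahiPositive_of_pushWeight_of_retract hRmono hRE
    (sahiPositive_three_of_isFKGMeasure_prod₃ hFKG)

end Main

end

end Summit.CriticalPhenomena.PercolationContinuityZ3.Theorems.SahiThreeDim
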